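import Summits.NavierStokesRegularity.NavierStokesRegularity.Theses.HardyPointSink
import Summits.NavierStokesRegularity.NavierStokesRegularity.Theorems.HardyPointSinkHardyEnergyBoundHardyDissipationCriterion
import Summits.NavierStokesRegularity.NavierStokesRegularity.Theorems.HardyPointSinkHardyEnergyBoundLedger
import Summits.NavierStokesRegularity.NavierStokesRegularity.Theorems.HardyPointSinkHardyEnergyBoundLocalHardyIdentity
import Summits.NavierStokesRegularity.NavierStokesRegularity.Theorems.HardyPointSinkHardyEnergyBoundSolenoidalHardyFlux
import Summits.NavierStokesRegularity.NavierStokesRegularity.Theorems.HardyPointSinkHardyEnergyBoundSpaceTimeL3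
import Summits.NavierStokesRegularity.NavierStokesRegularity.Theorems.AxisymmetricExtremalityAxisymmetricKatoGlobalStubKatoLocalEnergyNearTop
import Summits.NavierStokesRegularity.NavierStokesRegularity.Theorems.AxisymmetricExtremalityAxisymmetricKatoGlobalReduction
import Literature.Analysis.FluidPDE.KatoMaximalTimeSingular
import Literature.Analysis.FluidPDE.RusinSverakLeraySolutions
import HarnessLib

/-!
# Route HardyPointSink — crux `HardyEnergyBound` (item stmt-NavierStokesRegularity-7979):
# a singularity must drink divergent head

Support file (theorems only, `--supports stmt-NavierStokesRegularity-7979`; lead c6 of the crux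
line, 2026-08-17).  The route's slogan — "the only source of the Hardy energy is the advective
influx of Bernoulli head; a singularity must drink divergent head" — is made an UNCONDITIONAL tree
theorem about every Kato solution from Clay data:

* `katoLocalEnergyNearTop` — the strip frame of a Kato solution smooth inside (normalised
  pressure, suitable on `(0, T) × ℝ³`, local energy classes reaching the final time): the
  axisymmetry-free content of `AxisymmetricKatoGlobal.Registered.stub_katoLocalEnergyNearTop`
  (p149176; Rusin–Šverák 2011 §4, Lemarié-Rieusset 2016 Thm. 15.1).
* `hardyDissipation_eq_top_of_isBackwardSingularPoint` — for a Kato solution `u` on `[0, T)`,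
  its classical representative `(v, p)` on `(0, T)` and a backward singular point `(T, x_*)` of
  `u`, the Hardy dissipation of `v` at the centre `x_*` is infinite on every box:
  `∫∫_{(T−δ,T)×B(x_*,ρ₀)} |∇v|²/|x − x_*| = ∞` (the criterion
  `hardyDissipation_eq_top_of_not_isBoundedNearTop` of
  `HardyPointSinkHardyEnergyBoundHardyDissipationCriterion.lean` applied to the smooth Kato
  representative); `…_iterated` is the sliced form `∫_{T−δ}^{T} (∫_{B} |∇v(s)|²/|x − x_*| dx) ds = ∞`
  in which the dissipation enters the ledger.
* `headInflux_unbounded_of_isBackwardSingularPoint` — **the slogan**: in the frame of the crux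
  (Clay datum, Kato solution `u` on `[0,T)`, classical representative `(v, p)`), at every backward
  singular point `(T, x_*)` and every scale `0 < R`, `R² < T`, the cumulative head influx toward
  `x_*`, `−2 I(x_*; T−R², t) = −2∫_{T−R²}^{t}∫_{B(x_*,R)} (|v|²/2 + Π_Riesz)⟨v, x − x_*⟩/|x − x_*|³`,
  tends to `+∞` as `t ↑ T`: by the landed point-sink LEDGER `Theorems.stub_hardyLedger_of`
  (`H + D ≤ C + ofReal(−2I)`) the influx dominates the Hardy dissipation `D(t) − C`, and `D(t) ↑ ∞`.
* `not_isBackwardSingularPoint_of_headInflux_le` — contrapositive: a point toward which the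
  cumulative head influx stays bounded above at some scale is not singular.  So the planners'
  alternative layer-2 target `HeadInfluxBound` ("influx BOUNDED near every point") excludes every
  singular point whatever its type — it is regularity itself, not a weakening of it; only the
  ABSORPTION form `−2I ≤ D + M` (the registered heart `stub_influxAbsorption` ≡ C2, p153587) is a
  faithful layer-2 statement (HEART.md §3(c), now a theorem).

References: L. Caffarelli, R. Kohn, L. Nirenberg, Comm. Pure Appl. Math. 35 (1982), §2, §8
[CKN1982]; G. Seregin, *Lecture Notes on Regularity Theory for the Navier–Stokes Equations*
(2014), Ch. 6, Thm. 1.4 [Seregin2014]; W. Rusin, V. Šverák, J. Funct. Anal. 260 (2011), §3–4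
[RusinSverak2011].
-/

-- the problem directory repeats the summit name (D-0017); core's `dupNamespace` linter fires
set_option linter.dupNamespace false

noncomputable section

open Set MeasureTheory Filter Topology TopologicalSpace Function Metric Module
open scoped ENNReal NNReal
open Literature.Analysis.FluidPDE Literature.Analysis.FunctionSpaces

namespace Summit.NavierStokesRegularity.NavierStokesRegularity.Theorems

open AxisymmetricKatoGlobal.Registered

/-! ### The strip frame of a smooth Kato solution -/

/-- **The local energy classes of a smooth Kato solution reach the final time** (Rusin–Šverák
2011 §4 p. 6; Lemarié-Rieusset 2016, Prop. 15.1 / Thm. 15.1): for `ν > 0`, `T > 0` and a Kato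
solution `u` on `[0, T)`, smooth on `(0, T) × ℝ³`, the pair `(u, p̃[u])` (`normalisedPressure`) is a
suitable weak solution of the unforced Navier–Stokes equations on the open strip, and for every
`0 < t₁ < T`, `ρ > 0`: `sup_{t₁<t<T} ∫_{B_ρ}|u(t)|² < ∞`, `∫_{t₁}^{T}∫_{B_ρ}|∇u|² < ∞`,
`∫_{t₁}^{T}∫_{B_ρ}|p̃|^{3/2} < ∞`.  The axisymmetry-free content of
`AxisymmetricKatoGlobal.Registered.stub_katoLocalEnergyNearTop` (same proof: restart at the bounded
slice `u(t₁/2)` and translate back). [cite: RusinSverak2011, §4 p. 6 (arXiv:0911.0500)] -/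
theorem katoLocalEnergyNearTop {ν T : ℝ} (hν : 0 < ν) (hT : 0 < T)
    {u₀ : EuclideanSpace ℝ (Fin 3) → EuclideanSpace ℝ (Fin 3)}
    {u : ℝ → EuclideanSpace ℝ (Fin 3) → EuclideanSpace ℝ (Fin 3)} (hu : IsKatoSolutionOn T ν u₀ u)
    (hsm : ContDiffOn ℝ (⊤ : ℕ∞) (uncurry u) (Ioo 0 T ×ˢ univ)) :
    IsSuitableWeakSolutionOn (slab (EuclideanSpace ℝ (Fin 3)) (Ioo 0 T) isOpen_Ioo) ν 0 u
        (fun t => normalisedPressure (u t)) ∧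
      ∀ t₁ ∈ Ioo 0 T, ∀ ρ : ℝ, 0 < ρ →
        (∃ C : ℝ≥0, ∀ t ∈ Ioo t₁ T,
            ∫⁻ x in ball (0 : EuclideanSpace ℝ (Fin 3)) ρ, ‖u t x‖ₑ ^ 2 ≤ C) ∧
        (∫⁻ z in Ioo t₁ T ×ˢ ball (0 : EuclideanSpace ℝ (Fin 3)) ρ,
            ENNReal.ofReal (frobeniusNormSq (fderiv ℝ (u z.1) z.2)) < ∞) ∧
        (∫⁻ z in Ioo t₁ T ×ˢ ball (0 : EuclideanSpace ℝ (Fin 3)) ρ,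
            ‖(fun t => normalisedPressure (u t)) z.1 z.2‖ₑ ^ (3 / 2 : ℝ) < ∞) := by
  refine ⟨KatoNearTop.suitable_normalisedPressure_strip hν hu hT, fun t₁ ht₁ ρ _hρ => ?_⟩
  set s : ℝ := t₁ / 2 with hs_def
  have hs : s ∈ Ioo 0 T := ⟨by rw [hs_def]; linarith [ht₁.1], by rw [hs_def]; linarith [ht₁.1, ht₁.2]⟩
  have hst₁ : s < t₁ := by rw [hs_def]; linarith [ht₁.1]
  obtain ⟨M, hM0, hMb⟩ := KatoNearTop.exists_forall_norm_slice_le hν hu hsm hs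
  have hv : IsKatoSolutionOn (T - s) ν (u s) (fun t => u (s + t)) := hu.restart hν ⟨hs.1.le, hs.2⟩
  obtain ⟨⟨C, hC⟩, hD⟩ := KatoNearTop.local_energy_bounds (ρ := ρ) hν hv (by linarith [hs.2]) hM0 hMb
    (KatoNearTop.isSmoothSpaceTimeOn_restart hsm hs.1.le) (sub_pos.2 hst₁)
  refine ⟨⟨C, fun t ht => ?_⟩, ?_, ?_⟩
  · -- energy: `u(t) = ũ(t - s)`
    have h : ∫⁻ x in ball (0 : EuclideanSpace ℝ (Fin 3)) ρ, ‖u (s + (t - s)) x‖ₑ ^ 2 ≤ C :=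
      hC (t - s) ⟨by linarith [ht.1], by linarith [ht.2]⟩
    rwa [add_sub_cancel] at h
  · -- dissipation: translate back in time
    rw [← setLIntegral_prod_timeShift s t₁ T (ball (0 : EuclideanSpace ℝ (Fin 3)) ρ)
      (fun z : ℝ × EuclideanSpace ℝ (Fin 3) => ENNReal.ofReal (frobeniusNormSq (fderiv ℝ (u z.1) z.2)))]
    exact hD
  · -- pressure: `∫_{t₁}^T∫_{B_ρ} |p|^{3/2} ≤ ∫_s^T∫ |p|^{3/2} < ∞`
    exact lt_of_le_of_lt (lintegral_mono_set (prod_mono (Ioo_subset_Ioo_left hst₁.le) (subset_univ _)))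
      (KatoNearTop.lintegral_normalisedPressure_lt_top_of_bounded_slice hν hu hs hMb)

/-! ### The Hardy dissipation diverges at every backward singular point -/

/-- **At a backward singular point the Hardy dissipation at the centre is infinite.**  For `ν > 0`,
`T > 0`, a Kato solution `u` on `[0, T)` from `u₀`, a classical solution `(v, p)` on `(0, T)`
representing it (`v t = u t` a.e. for `0 < t < T`; `mild_L3_smooth_holds` provides one) and a
backward singular point `(T, x_*)` of `u` (`IsBackwardSingularPoint`: `u` essentially unbounded on
every `Q_r(T, x_*)`): `∫∫_{(T−δ,T)×B(x_*,ρ₀)} |∇v|²/|x − x_*| dx dt = ∞` for all `δ, ρ₀ > 0`.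
Proof: the field `u'` equal to `v` on `(0,T)` and to `u` elsewhere is a smooth Kato solution from
`u₀` (slices changed on null sets), singular at `(T, x_*)` (`eLpNorm_parabolicCylinder_eq_top_of_ae_eq`),
hence not bounded near `(T, x_*)`; `katoLocalEnergyNearTop` puts it in the strip frame and
`hardyDissipation_eq_top_of_not_isBoundedNearTop` applies (after shrinking `δ` below `T`).
[cite: Seregin2014, Ch. 6 §6.1 Theorem 1.4, PDF p. 94] -/
theorem hardyDissipation_eq_top_of_isBackwardSingularPoint {ν : ℝ} (hν : 0 < ν)
    {u₀ : EuclideanSpace ℝ (Fin 3) → EuclideanSpace ℝ (Fin 3)} {T : ℝ} (hT : 0 < T)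
    {u : ℝ → EuclideanSpace ℝ (Fin 3) → EuclideanSpace ℝ (Fin 3)} (hu : IsKatoSolutionOn T ν u₀ u)
    {v : ℝ → EuclideanSpace ℝ (Fin 3) → EuclideanSpace ℝ (Fin 3)}
    {p : ℝ → EuclideanSpace ℝ (Fin 3) → ℝ} (hcl : IsClassicalNSSolutionOn (Ioo 0 T) ν 0 v p)
    (hae : ∀ t ∈ Ioo 0 T, v t =ᵐ[volume] u t)
    {xs : EuclideanSpace ℝ (Fin 3)}
    (hsing : IsBackwardSingularPoint u ((T, xs) : ℝ × EuclideanSpace ℝ (Fin 3)))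
    {δ ρ₀ : ℝ} (hδ : 0 < δ) (hρ₀ : 0 < ρ₀) :
    ∫⁻ z in Ioo (T - δ) T ×ˢ ball xs ρ₀,
      ENNReal.ofReal (frobeniusNormSq (fderiv ℝ (v z.1) z.2)) / ‖z.2 - xs‖ₑ = ∞ := by
  -- ### the smooth Kato representative `u'` (pattern of `Registered.stub_katoAxisymSingularPoint`)
  set u' : ℝ → EuclideanSpace ℝ (Fin 3) → EuclideanSpace ℝ (Fin 3) :=
    fun t => if t ∈ Ioo 0 T then v t else u t with hu'_def
  have hu'_in : ∀ t ∈ Ioo 0 T, u' t = v t := fun t ht => by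
    simp only [hu'_def]
    exact if_pos ht
  have hu'_ae : ∀ t ∈ Ico 0 T, u' t =ᵐ[volume] u t := by
    intro t ht
    by_cases hto : t ∈ Ioo 0 T
    · rw [hu'_in t hto]
      exact hae t hto
    · have : u' t = u t := by
        simp only [hu'_def]
        exact if_neg hto
      rw [this]
  have hstrip : IsOpen (Ioo (0 : ℝ) T ×ˢ (univ : Set (EuclideanSpace ℝ (Fin 3)))) :=
    isOpen_Ioo.prod isOpen_univ
  have hu'_eqOn : EqOn (uncurry u') (uncurry v) (Ioo 0 T ×ˢ univ) := by
    rintro ⟨t, x⟩ ⟨ht, -⟩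
    simp [hu'_in t ht]
  have hw : IsSmoothSpaceTimeOn (Ioo 0 T) v := hcl.smooth_velocity
  have hu'_meas : AEStronglyMeasurable (uncurry u') (volume.restrict (Ioo 0 T ×ˢ univ)) := by
    refine (hw.continuousOn.aestronglyMeasurable hstrip.measurableSet).congr ?_
    filter_upwards [ae_restrict_mem hstrip.measurableSet] with z hz
    exact (hu'_eqOn hz).symm
  have hu' : IsKatoSolutionOn T ν u₀ u' := by
    refine ⟨hu.mild.congr_ae_Ico hu'_ae EventuallyEq.rfl,
      hu.continuousInLpOn.congr_ae_slices hu'_ae, ?_, hu'_meas⟩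
    have h0 : (0 : ℝ) ∉ Ioo 0 T := fun h => lt_irrefl _ h.1
    have : u' 0 = u 0 := by
      simp only [hu'_def]
      exact if_neg h0
    rw [this, hu.initial]
  have hsm' : ContDiffOn ℝ (⊤ : ℕ∞) (uncurry u') (Ioo 0 T ×ˢ univ) := hw.congr hu'_eqOn
  -- ### `(T, xs)` is singular for `u'`, so `u'` is not bounded near `(T, xs)`
  have hae' : uncurry u' =ᵐ[volume.restrict (Ioo 0 T ×ˢ univ)] uncurry u :=
    ae_restrict_prod_of_forall_ae_eq (fun t ht => hu'_ae t ⟨ht.1.le, ht.2⟩) hu'_meas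
      hu.aestronglyMeasurable
  have hsing' : ∀ r : ℝ, 0 < r → eLpNorm (uncurry u') ∞
      (volume.restrict (parabolicCylinder r ((T, xs) : ℝ × EuclideanSpace ℝ (Fin 3)))) = ∞ :=
    fun r hr => eLpNorm_parabolicCylinder_eq_top_of_ae_eq hT hae' xs hsing hr
  have hnot : ¬ IsBoundedNearTop u' T xs := by
    rintro ⟨r, hr, M, hbd⟩
    exact absurd (hsing' r hr) (eLpNorm_parabolicCylinder_lt_top_of_forall_le hbd).ne
  -- ### the strip frame and the criterion, on the shrunk window `δ₁ = min δ T`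
  obtain ⟨hsw, hloc⟩ := katoLocalEnergyNearTop hν hT hu' hsm'
  set δ₁ : ℝ := min δ T with hδ₁
  have hδ₁pos : 0 < δ₁ := lt_min hδ hT
  have hδ₁δ : δ₁ ≤ δ := min_le_left _ _
  have hδ₁T : δ₁ ≤ T := min_le_right _ _
  have htop := hardyDissipation_eq_top_of_not_isBoundedNearTop hν hT hsm' hsw hloc hnot hδ₁pos hρ₀
  -- on `(T - δ₁, T) ⊆ (0, T)` the representative is `v`
  have hcongr : ∫⁻ z in Ioo (T - δ₁) T ×ˢ ball xs ρ₀,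
      ENNReal.ofReal (frobeniusNormSq (fderiv ℝ (u' z.1) z.2)) / ‖z.2 - xs‖ₑ =
      ∫⁻ z in Ioo (T - δ₁) T ×ˢ ball xs ρ₀,
        ENNReal.ofReal (frobeniusNormSq (fderiv ℝ (v z.1) z.2)) / ‖z.2 - xs‖ₑ := by
    refine setLIntegral_congr_fun (measurableSet_Ioo.prod measurableSet_ball) fun z hz => ?_
    have hz1 : z.1 ∈ Ioo 0 T := ⟨by linarith [(mem_prod.1 hz).1.1], (mem_prod.1 hz).1.2⟩
    rw [hu'_in z.1 hz1]
  rw [hcongr] at htop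
  refine eq_top_iff.2 (le_trans (eq_top_iff.1 htop) (lintegral_mono_set ?_))
  exact prod_mono (Ioo_subset_Ioo_left (by linarith)) subset_rfl

/-- **Sliced form.**  In the setting of `hardyDissipation_eq_top_of_isBackwardSingularPoint` the
ITERATED Hardy dissipation — the quantity entering the point-sink ledger — is infinite as well:
`∫_{T−δ}^{T} (∫_{B(x_*,ρ₀)} |∇v(s,x)|²/|x − x_*| dx) ds = ∞` (Tonelli's inequality
`lintegral_prod_le`, no measurability needed). [cite: Seregin2014, Ch. 6 §6.1 Theorem 1.4, PDF p. 94] -/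
theorem hardyDissipation_eq_top_of_isBackwardSingularPoint_iterated {ν : ℝ} (hν : 0 < ν)
    {u₀ : EuclideanSpace ℝ (Fin 3) → EuclideanSpace ℝ (Fin 3)} {T : ℝ} (hT : 0 < T)
    {u : ℝ → EuclideanSpace ℝ (Fin 3) → EuclideanSpace ℝ (Fin 3)} (hu : IsKatoSolutionOn T ν u₀ u)
    {v : ℝ → EuclideanSpace ℝ (Fin 3) → EuclideanSpace ℝ (Fin 3)}
    {p : ℝ → EuclideanSpace ℝ (Fin 3) → ℝ} (hcl : IsClassicalNSSolutionOn (Ioo 0 T) ν 0 v p)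
    (hae : ∀ t ∈ Ioo 0 T, v t =ᵐ[volume] u t)
    {xs : EuclideanSpace ℝ (Fin 3)}
    (hsing : IsBackwardSingularPoint u ((T, xs) : ℝ × EuclideanSpace ℝ (Fin 3)))
    {δ ρ₀ : ℝ} (hδ : 0 < δ) (hρ₀ : 0 < ρ₀) :
    ∫⁻ s in Ioo (T - δ) T, ∫⁻ x in ball xs ρ₀,
      ENNReal.ofReal (frobeniusNormSq (fderiv ℝ (v s) x)) / ‖x - xs‖ₑ = ∞ := by
  have hprod := hardyDissipation_eq_top_of_isBackwardSingularPoint hν hT hu hcl hae hsing hδ hρ₀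
  have hle : ∫⁻ z in Ioo (T - δ) T ×ˢ ball xs ρ₀,
      ENNReal.ofReal (frobeniusNormSq (fderiv ℝ (v z.1) z.2)) / ‖z.2 - xs‖ₑ ≤
      ∫⁻ s in Ioo (T - δ) T, ∫⁻ x in ball xs ρ₀,
        ENNReal.ofReal (frobeniusNormSq (fderiv ℝ (v s) x)) / ‖x - xs‖ₑ := by
    rw [Measure.volume_eq_prod, ← Measure.prod_restrict]
    exact lintegral_prod_le _
  exact eq_top_iff.2 (le_trans (eq_top_iff.1 hprod) hle)

/-! ### A singularity must drink divergent head -/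

/-- **A SINGULARITY MUST DRINK DIVERGENT HEAD.**  In the frame of the crux `HardyEnergyBound`
(`ν > 0`, Clay datum `u₀`, `T > 0`, Kato solution `u` on `[0, T)` from `u₀`, classical
representative `(v, p)` on `(0, T)` with `v t = u t` a.e.), at every backward singular point
`(T, x_*)` of `u` and every scale `0 < R`, `R² < T`, the cumulative influx of Bernoulli head toward
`x_*` through `B(x_*, R)`,
`−2 I(t) = −2 ∫_{T−R²}^{t} ∫_{B(x_*,R)} (|v|²/2 + Π_Riesz[v(s)]) ⟨v, x − x_*⟩/|x − x_*|³ dx ds`,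
is UNBOUNDED ABOVE as `t ↑ T`, uniformly from some time on: for every `M` there is
`t₁ ∈ [T−R², T)` with `M ≤ −2 I(t)` for all `t ∈ [t₁, T)`.  Proof: the landed point-sink ledger
`Theorems.stub_hardyLedger_of` gives `H + D(t) ≤ C + ofReal(−2I(t))` at the sink `x₀ = x_*`, where
`D(t) ≥ 2ν ∫_{T−R²}^{t}∫_{B(x_*,R/2)} |∇v|²/|x − x_*|` increases to `+∞` as `t ↑ T`
(`hardyDissipation_eq_top_of_isBackwardSingularPoint_iterated`, continuity from below
`setLIntegral_iUnion_of_directed`). [cite: CaffarelliKohnNirenberg1982, §2 and §8] -/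
theorem headInflux_unbounded_of_isBackwardSingularPoint {ν : ℝ} (hν : 0 < ν)
    {u₀ : EuclideanSpace ℝ (Fin 3) → EuclideanSpace ℝ (Fin 3)} (hsm₀ : ContDiff ℝ (⊤ : ℕ∞) u₀)
    (hdiv : NSWave0.IsDivFree u₀) (hdec : HasRapidSpatialDecay u₀) {T : ℝ} (hT : 0 < T)
    {u : ℝ → EuclideanSpace ℝ (Fin 3) → EuclideanSpace ℝ (Fin 3)} (hu : IsKatoSolutionOn T ν u₀ u)
    {v : ℝ → EuclideanSpace ℝ (Fin 3) → EuclideanSpace ℝ (Fin 3)}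
    {p : ℝ → EuclideanSpace ℝ (Fin 3) → ℝ} (hcl : IsClassicalNSSolutionOn (Ioo 0 T) ν 0 v p)
    (hae : ∀ t ∈ Ioo 0 T, v t =ᵐ[volume] u t)
    {xs : EuclideanSpace ℝ (Fin 3)}
    (hsing : IsBackwardSingularPoint u ((T, xs) : ℝ × EuclideanSpace ℝ (Fin 3)))
    {R : ℝ} (hR : 0 < R) (hRT : R ^ 2 < T) (M : ℝ) :
    ∃ t₁ ∈ Ico (T - R ^ 2) T, ∀ t ∈ Ico t₁ T,
      M ≤ -2 * ∫ s in (T - R ^ 2)..t, ∫ x in ball xs R,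
        (‖v s x‖ ^ 2 / 2 + rieszPressure (v s) x) * inner ℝ (v s x) (x - xs) / ‖x - xs‖ ^ 3 := by
  -- ### the ledger at the sink `x₀ = xs`
  obtain ⟨C, hC⟩ := stub_hardyLedger_of stub_localHardyIdentity stub_solenoidalHardyFlux stub_spaceTimeL3
    ν hν u₀ hsm₀ hdiv hdec T u hT hu v p hcl hae xs R hR hRT
  have hxs : xs ∈ ball xs (R / 4) := mem_ball_self (by positivity)
  -- the sliced Hardy dissipation at the centre and its primitive `G`
  set W : ℝ → ℝ≥0∞ := fun s => ∫⁻ x in ball xs (R / 2),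
    ENNReal.ofReal (frobeniusNormSq (fderiv ℝ (v s) x)) / ‖x - xs‖ₑ with hW
  set G : ℝ → ℝ≥0∞ := fun t => ∫⁻ s in Ioo (T - R ^ 2) t, W s with hG
  have hGmono : ∀ {a b : ℝ}, a ≤ b → G a ≤ G b := fun hab =>
    lintegral_mono_set (Ioo_subset_Ioo_right hab)
  -- `G(T) = ∞` (the sliced divergence with `δ = R²`, `ρ₀ = R/2`)
  have hGT : G T = ∞ :=
    hardyDissipation_eq_top_of_isBackwardSingularPoint_iterated hν hT hu hcl hae hsing
      (pow_pos hR 2) (by positivity)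
  -- continuity from below along `tₙ = T - R²/(n+2) ↑ T`
  set tn : ℕ → ℝ := fun n => T - R ^ 2 / ((n : ℝ) + 2) with htn
  have htn_mem : ∀ n, tn n ∈ Ico (T - R ^ 2) T := by
    intro n
    have h2 : (0 : ℝ) < (n : ℝ) + 2 := by positivity
    have h3 : R ^ 2 / ((n : ℝ) + 2) < R ^ 2 := by
      rw [div_lt_iff₀ h2]; nlinarith [pow_pos hR 2]
    have h4 : 0 < R ^ 2 / ((n : ℝ) + 2) := by positivity
    simp only [htn, mem_Ico]
    constructor <;> linarith
  have htn_mono : Monotone tn := by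
    intro m n hmn
    simp only [htn]
    have h1 : (m : ℝ) + 2 ≤ n + 2 := by exact_mod_cast Nat.add_le_add_right hmn 2
    have h2 : R ^ 2 / ((n : ℝ) + 2) ≤ R ^ 2 / ((m : ℝ) + 2) :=
      div_le_div_of_nonneg_left (pow_pos hR 2).le (by positivity) h1
    linarith
  have hUnion : ⋃ n, Ioo (T - R ^ 2) (tn n) = Ioo (T - R ^ 2) T := by
    ext s
    simp only [mem_iUnion, mem_Ioo]
    constructor
    · rintro ⟨n, h1, h2⟩
      exact ⟨h1, h2.trans (htn_mem n).2⟩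
    · rintro ⟨h1, h2⟩
      have hpos : 0 < T - s := by linarith
      obtain ⟨n, hn⟩ := exists_nat_ge (R ^ 2 / (T - s))
      refine ⟨n, h1, ?_⟩
      simp only [htn]
      have h5 : R ^ 2 / ((n : ℝ) + 2) < T - s := by
        rw [div_lt_iff₀ (by positivity)]
        have h6 : R ^ 2 ≤ (n : ℝ) * (T - s) := by rwa [div_le_iff₀ hpos] at hn
        nlinarith
      linarith
  have hdir : Directed (· ⊆ ·) fun n => Ioo (T - R ^ 2) (tn n) :=
    Monotone.directed_le fun m n hmn => Ioo_subset_Ioo_right (htn_mono hmn)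
  have hsup : ⨆ n, G (tn n) = ∞ := by
    rw [← hGT, hG]
    simp only
    rw [← hUnion, setLIntegral_iUnion_of_directed _ hdir]
  -- ### choose `n` with `2ν · G(tₙ) > C + max M 0`
  have h2ν0 : ENNReal.ofReal (2 * ν) ≠ 0 := (ENNReal.ofReal_pos.2 (by positivity)).ne'
  set B : ℝ≥0∞ := (C : ℝ≥0∞) + ENNReal.ofReal (max M 0) with hB
  have hBtop : B < ∞ := ENNReal.add_lt_top.2 ⟨ENNReal.coe_lt_top, ENNReal.ofReal_lt_top⟩
  have hquot : B / ENNReal.ofReal (2 * ν) < ⨆ n, G (tn n) := by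
    rw [hsup]
    exact ENNReal.div_lt_top hBtop.ne h2ν0
  obtain ⟨n, hn⟩ := lt_iSup_iff.1 hquot
  have hnB : B < ENNReal.ofReal (2 * ν) * G (tn n) := by
    have := (ENNReal.div_lt_iff (Or.inl h2ν0) (Or.inl ENNReal.ofReal_ne_top)).1 hn
    rwa [mul_comm] at this
  refine ⟨tn n, htn_mem n, fun t ht => ?_⟩
  -- ### at `t ∈ [tₙ, T)`: `C + max M 0 < 2ν G(t) ≤ D(t) ≤ C + ofReal(−2I(t))`
  have htI : t ∈ Ico (T - R ^ 2) T := ⟨(htn_mem n).1.trans ht.1, ht.2⟩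
  have hled := hC xs hxs t htI
  set X : ℝ≥0∞ := ENNReal.ofReal (-2 * ∫ s in (T - R ^ 2)..t, ∫ x in ball xs R,
    (‖v s x‖ ^ 2 / 2 + rieszPressure (v s) x) * inner ℝ (v s x) (x - xs) / ‖x - xs‖ ^ 3) with hX
  have hDlow : ENNReal.ofReal (2 * ν) * G t ≤
      ∫⁻ s in Ioo (T - R ^ 2) t, (ENNReal.ofReal (2 * ν) * W s +
        ENNReal.ofReal (4 * Real.pi * ν) * ‖v s xs‖ₑ ^ 2) := by
    rw [hG]
    simp only
    rw [← lintegral_const_mul' _ _ ENNReal.ofReal_ne_top]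
    exact lintegral_mono fun s => le_self_add
  have hchain : B < (C : ℝ≥0∞) + X := by
    calc B < ENNReal.ofReal (2 * ν) * G (tn n) := hnB
      _ ≤ ENNReal.ofReal (2 * ν) * G t := mul_le_mul_right (hGmono ht.1) _
      _ ≤ ∫⁻ s in Ioo (T - R ^ 2) t, (ENNReal.ofReal (2 * ν) * W s +
            ENNReal.ofReal (4 * Real.pi * ν) * ‖v s xs‖ₑ ^ 2) := hDlow
      _ ≤ (∫⁻ x in ball xs (R / 4), ‖v t x‖ₑ ^ 2 / ‖x - xs‖ₑ) +
            ∫⁻ s in Ioo (T - R ^ 2) t, (ENNReal.ofReal (2 * ν) * W s +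
              ENNReal.ofReal (4 * Real.pi * ν) * ‖v s xs‖ₑ ^ 2) := le_add_self
      _ ≤ (C : ℝ≥0∞) + X := hled
  have hMX : ENNReal.ofReal (max M 0) < X := by
    rw [hB] at hchain
    exact (ENNReal.add_lt_add_iff_left ENNReal.coe_ne_top).1 hchain
  have hreal : max M 0 < -2 * ∫ s in (T - R ^ 2)..t, ∫ x in ball xs R,
      (‖v s x‖ ^ 2 / 2 + rieszPressure (v s) x) * inner ℝ (v s x) (x - xs) / ‖x - xs‖ ^ 3 := by
    rw [hX] at hMX
    exact (ENNReal.ofReal_lt_ofReal_iff_of_nonneg (le_max_right _ _)).1 hMX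
  exact (le_max_left M 0).trans hreal.le

/-- **Contrapositive — bounded head influx at some scale excludes the singularity.**  In the frame
of the crux, if at a centre `x_*` and some scale `0 < R`, `R² < T` the cumulative head influx
toward `x_*` is bounded above up to the final time, `−2 I(x_*; T−R², t) ≤ M` for all
`t ∈ [T−R², T)`, then `(T, x_*)` is NOT a backward singular point of the Kato solution.  Hence the
planners' alternative layer-2 target `HeadInfluxBound` (influx bounded toward every point) already
excludes every singular point — it is not weaker than regularity; the faithful layer-2 form is the
ABSORPTION inequality of the registered heart. [cite: CaffarelliKohnNirenberg1982, §2 and §8] -/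
theorem not_isBackwardSingularPoint_of_headInflux_le {ν : ℝ} (hν : 0 < ν)
    {u₀ : EuclideanSpace ℝ (Fin 3) → EuclideanSpace ℝ (Fin 3)} (hsm₀ : ContDiff ℝ (⊤ : ℕ∞) u₀)
    (hdiv : NSWave0.IsDivFree u₀) (hdec : HasRapidSpatialDecay u₀) {T : ℝ} (hT : 0 < T)
    {u : ℝ → EuclideanSpace ℝ (Fin 3) → EuclideanSpace ℝ (Fin 3)} (hu : IsKatoSolutionOn T ν u₀ u)
    {v : ℝ → EuclideanSpace ℝ (Fin 3) → EuclideanSpace ℝ (Fin 3)}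
    {p : ℝ → EuclideanSpace ℝ (Fin 3) → ℝ} (hcl : IsClassicalNSSolutionOn (Ioo 0 T) ν 0 v p)
    (hae : ∀ t ∈ Ioo 0 T, v t =ᵐ[volume] u t)
    {xs : EuclideanSpace ℝ (Fin 3)} {R : ℝ} (hR : 0 < R) (hRT : R ^ 2 < T) {M : ℝ}
    (hbdd : ∀ t ∈ Ico (T - R ^ 2) T,
      -2 * ∫ s in (T - R ^ 2)..t, ∫ x in ball xs R,
        (‖v s x‖ ^ 2 / 2 + rieszPressure (v s) x) * inner ℝ (v s x) (x - xs) / ‖x - xs‖ ^ 3 ≤ M) :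
    ¬ IsBackwardSingularPoint u ((T, xs) : ℝ × EuclideanSpace ℝ (Fin 3)) := by
  intro hsing
  obtain ⟨t₁, ht₁, hM⟩ := headInflux_unbounded_of_isBackwardSingularPoint hν hsm₀ hdiv hdec hT hu
    hcl hae hsing hR hRT (M + 1)
  have h := hM t₁ ⟨le_rfl, ht₁.2⟩
  have h' := hbdd t₁ ht₁
  linarith

/-- **Anchor `hardyEnergyBound_headInflux_unbounded` (lead c6, `--supports
stmt-NavierStokesRegularity-7979`): a singularity must drink divergent head.**  In the frame of
the crux `HardyEnergyBound` (Clay datum, Kato solution on `[0,T)`, classical representative), at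
every backward singular point `(T, x_*)` and every scale `0 < R`, `R² < T`, the cumulative head
influx `−2 I(x_*; T−R², t)` exceeds every bound for all `t` close to `T`
(`headInflux_unbounded_of_isBackwardSingularPoint`). [cite: CaffarelliKohnNirenberg1982, §2 and §8] -/
theorem hardyEnergyBound_headInflux_unbounded :
    ∀ ν : ℝ, 0 < ν → ∀ u₀ : EuclideanSpace ℝ (Fin 3) → EuclideanSpace ℝ (Fin 3),
      ContDiff ℝ (⊤ : ℕ∞) u₀ → Literature.Analysis.FluidPDE.NSWave0.IsDivFree u₀ →
      Literature.Analysis.FluidPDE.HasRapidSpatialDecay u₀ →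
      ∀ (T : ℝ) (u : ℝ → EuclideanSpace ℝ (Fin 3) → EuclideanSpace ℝ (Fin 3)), 0 < T →
      Literature.Analysis.FluidPDE.IsKatoSolutionOn T ν u₀ u →
      ∀ (v : ℝ → EuclideanSpace ℝ (Fin 3) → EuclideanSpace ℝ (Fin 3))
        (p : ℝ → EuclideanSpace ℝ (Fin 3) → ℝ),
      Literature.Analysis.FluidPDE.IsClassicalNSSolutionOn (Set.Ioo 0 T) ν 0 v p →
      (∀ t ∈ Set.Ioo 0 T, v t =ᵐ[MeasureTheory.volume] u t) →
      ∀ xs : EuclideanSpace ℝ (Fin 3),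
        Literature.Analysis.FluidPDE.IsBackwardSingularPoint u ((T, xs) : ℝ × EuclideanSpace ℝ (Fin 3)) →
        ∀ R : ℝ, 0 < R → R ^ 2 < T → ∀ M : ℝ,
          ∃ t₁ ∈ Set.Ico (T - R ^ 2) T, ∀ t ∈ Set.Ico t₁ T,
            M ≤ -2 * ∫ s in (T - R ^ 2)..t, ∫ x in Metric.ball xs R,
              (‖v s x‖ ^ 2 / 2 + Literature.Analysis.FluidPDE.rieszPressure (v s) x)
                * inner ℝ (v s x) (x - xs) / ‖x - xs‖ ^ 3 :=
  fun _ν hν _u₀ hsm₀ hdiv hdec _T _u hT hu _v _p hcl hae _xs hsing _R hR hRT M =>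
    headInflux_unbounded_of_isBackwardSingularPoint hν hsm₀ hdiv hdec hT hu hcl hae hsing hR hRT M

end Summit.NavierStokesRegularity.NavierStokesRegularity.Theorems

end
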